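import Summits.NavierStokesRegularity.NavierStokesRegularity.Theses.FilamentSkeletonRss
import HarnessLib.Audit

/-!
# Line `kelvin-sonic-negation` — a NEGATION skeleton for the crux `FilamentSkeletonRss.SkeletonEquilibrium`
(crux item stmt-NavierStokesRegularity-15400; strategist `planner-cstrat-stmt-NavierStokesRegularity-15400-s1-0`,
2026-08-17; card `Lines/kelvin-sonic-negation.md`, census `STRATEGY-CENSUS.md`, idea `Ideas/kelvin-sonic-obstruction.md`)

The crux is FIXED (by name). This file composes THREE registered stubs into `¬ SkeletonEquilibrium`:

* `stub_lengthRegular` (size L; conjectural-but-mild): equilibria of the regularised Biot–Savart law in the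
  rotating Leray frame are LENGTH-REGULAR at the separation scale — the arclength of any filament inside a ball of
  radius `D ≥ √Γ` is `≤ C₀ D`, with `C₀` depending only on the data `(N, γ, α, ρ, K)` (no dense coiling).
* `stub_kelvinSonicVerticality` (size XL; THE mechanism, the Kelvin-sonic selection): for FIXED data and `Γ → ∞`,
  every length-regular witness of the configuration clauses is `θ`-close to VERTICAL inside the ball of radius
  `R√Γ` around each stagnation point `Ξ_j(τ*)` (`w_j(τ*) = 0`), for every `θ > 0`, `R ≥ 1`, once `Γ ≥ Γ₁`.
  Mechanism (card §Mechanism; `STRATEGY-CENSUS.md` §Negation): along every proper end the slip `w ~ ½|Ξ|` exceeds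
  the maximal phase speed `0.2688·Γγ_j/(4π)` of (negative-helicity) Kelvin bending waves of the core-1 Rosenhead
  filament (exact multiplier `m(k) = 2 − 2kK₁(k) − 2k²K₀(k)`, sign change at `k₀ = 1.114`, folds of the steady
  characteristic set at `|Ξ| ≈ 0.54·Γγ/(4π)` and `0.78·Γγ/(4π)`); the steady linearised operator's bicharacteristics
  issued from the similarity-frame gyration ("Kelvin ripple", amplitude `C₀(θ, α)` of the outer binormal trajectory)
  are trapped: fold → return branch → transversal crossing of the stagnation point at `|k| = k₀` → second fold →
  radial sink at infinite wavenumber AT the stagnation point, where any nonzero amplitude is `|τ−τ*|^{μ}`-singular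
  (`Re μ = Re λ(B)/w′ < 2` always, since `tr B = 3/2 − w′`). Smooth (C²) steady witnesses must therefore be
  ripple-free on every end, i.e. `C₀(θ_launch, α) = o(1)`; the strategist's scan (`compute/gyration_scan.py`,
  `scan1.py`, `scan2.py`: 45×22×2 + 36×15 trajectories, RK4, asymptote fitted at s = 30…80) finds
  `C₀(θ, α) ≥ 0.34·|α|·sin θ` throughout (`≥ 0.646` for `|α| ≥ 1`, `θ ≥ 10°`) and `C₀ → 0` ONLY as `θ → 0` (vertical)
  or `α → 0` (excluded by the crux):
  hence launch directions — and, by stiffness (`κ = O(1/(√Γ log Γ))` inside the bending scale), the whole waist —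
  are vertical to `o(1)`.
* `stub_nearVerticalSubcritical` (size L; provable over Mathlib + the landed strain identity
  `Theorems/SkeletonEquilibrium/Negative/StrainIdentity.lean`): a length-regular configuration that is `θ`-vertical
  in the `R√Γ`-ball around a stagnation point has `w_j′(τ*) ≤ ½ + C(θ + 1/R)` there (near-vertical filaments induce
  axial strain `O(θ)`; parts outside the ball `O(1/R²)`; `C = C(N, γ, ρ, K, C₀)`), the perturbative form of the landed
  `CoreGluing.Negative.parallel_lines_not_supercritical` / `SkeletonEquilibrium.Negative.straight_lines_slope_half`.

Composition `not_SkeletonEquilibrium_of` (sorry-free): with `θ = 1/(4(C+1))`, `R = 4(C+1)` the bound is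
`w′(τ*) ≤ 1 < 3/2 + δ`, contradicting (SC) at the `Γ ≥ max Γ₁ 1` the crux provides.

## Disproof used
`Cruxes/SkeletonEquilibrium/Disproof.lean` (cdisprove c1): (a) (SC) is THE load-bearing clause — honoured: the line
attacks exactly (SC) (`w′ ≤ 1`); (b) the strain identity `w′ = ½ + axial strain` — used in `stub_nearVerticalSubcritical`;
(c1)/(c2) straight ⇒ vertical ⇒ `w′ ≡ ½` and parallel arrays subcritical — this line is their ASYMPTOTIC version
(witnesses are vertical to `o(1)`, hence subcritical to `o(1)`); (e2) tail law — consistent (`w′ → ½` on supersonic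
ends). No landed Negative lemma refutes any stub (they concern exact lines/planes; the stubs are perturbative).
-/

noncomputable section

open Set MeasureTheory Filter Topology
open Literature.Analysis.FluidPDE

namespace Summit.NavierStokesRegularity.NavierStokesRegularity.Cruxes.SkeletonEquilibrium.KelvinSonicNegation

set_option linter.unusedVariables false
set_option linter.dupNamespace false

/-- **STUB 0 (`stub_lengthRegular`; size L; conjectural, mild).** Relative equilibria of the regularised
Biot–Savart law (core 1, circulations `Γγ_k`) in the rotating Leray frame that satisfy the configuration clauses
of the crux at circulation `Γ ≥ 1` are LENGTH-REGULAR at scales `≥ √Γ`: the arclength (= Lebesgue measure of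
parameters, the curves being unit-speed) of any filament inside any ball of radius `D ≥ √Γ` is at most `C₀ D`,
`C₀` depending on the data only. Why plausibly true: inside the bending scale the filaments are straight to
`O(1/log Γ)` (stiffness of the local induction), beyond it the curvature clause `‖Ξ″‖√Γ ≤ K` forces the pitch
angle of any gyration about the drift to be `≤ 2K·(Γγ/4π)·log Γ/|Ξ|·√Γ…`, i.e. alignment, and aligned proper ends
cross each shell once; a densely coiled (solenoidal) filament cannot balance the radial Leray drift (helices and
rings are dead: `Disproof.lean`, lead memo c2 §1). Why it might fail: the clauses carry no self-chord-arc bound, so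
an exotic self-consistent coil at `|Ξ| ~ √Γ log Γ` is not excluded by anything proved. [conjecture] -/
theorem stub_lengthRegular :
    ∀ (N : ℕ) (γ : Fin N → ℝ) (α ρ K : ℝ), α ≠ 0 → 0 < ρ →
      ∃ C₀ : ℝ, 0 < C₀ ∧ ∀ Γ : ℝ, 1 ≤ Γ →
        ∀ (Ξ : Fin N → ℝ → EuclideanSpace ℝ (Fin 3)) (w : Fin N → ℝ → ℝ),
          (∀ j, ContDiff ℝ 2 (Ξ j) ∧ Function.Injective (Ξ j) ∧ Differentiable ℝ (w j) ∧
              (∀ τ, ‖deriv (Ξ j) τ‖ = 1) ∧ (∀ τ, ‖iteratedDeriv 2 (Ξ j) τ‖ * Real.sqrt Γ ≤ K) ∧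
              Tendsto (fun τ => ‖Ξ j τ‖) atTop atTop ∧ Tendsto (fun τ => ‖Ξ j τ‖) atBot atTop) →
          (∀ j k, j ≠ k → ∀ τ σ, ρ * Real.sqrt Γ ≤ ‖Ξ j τ - Ξ k σ‖) →
          (∀ j (x : EuclideanSpace ℝ (Fin 3)), Integrable (fun σ : ℝ =>
              ((‖x - Ξ j σ‖ ^ 2 + 1) ^ (3 / 2 : ℝ))⁻¹ • cross (deriv (Ξ j) σ) (x - Ξ j σ))) →
          (∀ j τ, (∑ k : Fin N, (Γ * γ k / (4 * Real.pi)) • ∫ σ : ℝ,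
                ((‖Ξ j τ - Ξ k σ‖ ^ 2 + 1) ^ (3 / 2 : ℝ))⁻¹ • cross (deriv (Ξ k) σ) (Ξ j τ - Ξ k σ))
              + (1 / 2 : ℝ) • Ξ j τ - α • cross (EuclideanSpace.single (2 : Fin 3) (1 : ℝ)) (Ξ j τ)
              = w j τ • deriv (Ξ j) τ) →
          ∀ (k : Fin N) (x : EuclideanSpace ℝ (Fin 3)) (D : ℝ), Real.sqrt Γ ≤ D →
            volume {τ : ℝ | ‖Ξ k τ - x‖ ≤ D} ≤ ENNReal.ofReal (C₀ * D) := by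
  sorry

/-- **STUB 1 (`stub_kelvinSonicVerticality`; size XL; THE new mathematics — the Kelvin-sonic selection).**
Fix the data `(N, γ, α ≠ 0, ρ > 0, K)`, a length-regularity constant `C₀`, a tolerance `θ > 0` and a radius
`R ≥ 1`. Then for all sufficiently large `Γ`, every `C₀`-length-regular configuration satisfying the crux's
per-filament, separation, integrability and relative-equilibrium clauses at circulation `Γ` is `θ`-VERTICAL
(`‖Ξ_k′(τ) × e₃‖ ≤ θ`) at every point of every filament lying in the ball of radius `R√Γ` around any stagnation
point `Ξ_j(τ*)`, `w_j(τ*) = 0`. Mechanism: smooth steady ends must be free of the similarity-frame Kelvin ripple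
(trapped bicharacteristics of the steady linearised operator `J·(Γγ/4π)·m(D) − w ∂_τ + B` end in a radial sink at
the stagnation point beyond the Kelvin-sonic folds `w = 0.2688·Γγ/4π`, `0.3900·Γγ/4π`), and the ripple amplitude
`C₀(θ_launch, α)` of the outer binormal trajectory `Y″ = ±Y′ × (½Y − α e₃ × Y)` from the origin vanishes only for
vertical launch (strategist scan: `C₀ ≥ 0.34·|α|·sin θ` on the grid, `C₀ ≈ √(2|α|)·sin θ` at small `θ`); stiffness then
makes the whole waist vertical. Why it might fail: (i) the microlocal argument is formal (uniformity in `e = Γ^{-1/2}`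
of the propagation / radial-point estimates for a NONLOCAL operator is unproved); (ii) exotic witnesses whose waist
sits at `|Ξ| ~ √Γ log Γ` with `O(K/√Γ)` curvature throughout are outside the two-scale picture; (iii) `C₀ > 0` is
numerical (RK4), not certified. Cheapest falsifier: a datum `(θ, α)`, `θ ∈ (0, π/2]`, `α ≠ 0`, whose outer trajectory
is asymptotically gyration-free (`C₀ = 0`), or a smooth steady solution of the saturating-dispersion toy model with a
persistent subsonic ripple. [conjecture] [cite: Benjamin1962, §4] [cite: MooreSaffman1972, §5] [cite: VanGorder2016, §6] -/
theorem stub_kelvinSonicVerticality :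
    ∀ (N : ℕ) (γ : Fin N → ℝ) (α ρ K C₀ : ℝ), α ≠ 0 → 0 < ρ → 0 < C₀ →
      ∀ θ : ℝ, 0 < θ → ∀ R : ℝ, 1 ≤ R → ∃ Γ₁ : ℝ, ∀ Γ : ℝ, Γ₁ ≤ Γ → 1 ≤ Γ →
        ∀ (Ξ : Fin N → ℝ → EuclideanSpace ℝ (Fin 3)) (w : Fin N → ℝ → ℝ),
          (∀ j, ContDiff ℝ 2 (Ξ j) ∧ Function.Injective (Ξ j) ∧ Differentiable ℝ (w j) ∧
              (∀ τ, ‖deriv (Ξ j) τ‖ = 1) ∧ (∀ τ, ‖iteratedDeriv 2 (Ξ j) τ‖ * Real.sqrt Γ ≤ K) ∧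
              Tendsto (fun τ => ‖Ξ j τ‖) atTop atTop ∧ Tendsto (fun τ => ‖Ξ j τ‖) atBot atTop) →
          (∀ j k, j ≠ k → ∀ τ σ, ρ * Real.sqrt Γ ≤ ‖Ξ j τ - Ξ k σ‖) →
          (∀ j (x : EuclideanSpace ℝ (Fin 3)), Integrable (fun σ : ℝ =>
              ((‖x - Ξ j σ‖ ^ 2 + 1) ^ (3 / 2 : ℝ))⁻¹ • cross (deriv (Ξ j) σ) (x - Ξ j σ))) →
          (∀ j τ, (∑ k : Fin N, (Γ * γ k / (4 * Real.pi)) • ∫ σ : ℝ,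
                ((‖Ξ j τ - Ξ k σ‖ ^ 2 + 1) ^ (3 / 2 : ℝ))⁻¹ • cross (deriv (Ξ k) σ) (Ξ j τ - Ξ k σ))
              + (1 / 2 : ℝ) • Ξ j τ - α • cross (EuclideanSpace.single (2 : Fin 3) (1 : ℝ)) (Ξ j τ)
              = w j τ • deriv (Ξ j) τ) →
          (∀ (k : Fin N) (x : EuclideanSpace ℝ (Fin 3)) (D : ℝ), Real.sqrt Γ ≤ D →
              volume {τ : ℝ | ‖Ξ k τ - x‖ ≤ D} ≤ ENNReal.ofReal (C₀ * D)) →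
          ∀ (j : Fin N) (τs : ℝ), w j τs = 0 →
            ∀ (k : Fin N) (τ : ℝ), ‖Ξ k τ - Ξ j τs‖ ≤ R * Real.sqrt Γ →
              ‖cross (deriv (Ξ k) τ) (EuclideanSpace.single (2 : Fin 3) (1 : ℝ))‖ ≤ θ := by
  sorry

/-- **STUB 2 (`stub_nearVerticalSubcritical`; size L; provable now in principle).** Near-vertical, length-regular
relative equilibria are SUBCRITICAL at their stagnation points: if a configuration satisfying the clauses at `Γ ≥ 1`
is `C₀`-length-regular and `θ`-vertical in the ball of radius `R√Γ` around a stagnation point `Ξ_j(τ*)`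
(`w_j(τ*) = 0`), then `w_j′(τ*) ≤ ½ + C(θ + 1/R)` with `C = C(N, γ, ρ, K, C₀)`. Proof sketch: the landed strain
identity (`Theorems/SkeletonEquilibrium/Negative/StrainIdentity.lean`: `w′ = ½ + ⟪(u_skel ∘ Ξ_j)′, Ξ_j′⟫`, `α` drops
out); the local-induction part of the self-strain is binormal and contributes `O(K²/Γ · log Γ)·0 + O(θ)`; a
`θ`-vertical unit-speed `C²` curve in the ball is a graph over the `z`-axis with slope `≤ 2θ` (chord–arc for free:
`z` is monotone), and the axial (`e₃e₃`) strain of the regularised Biot–Savart field of a VERTICAL line vanishes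
identically (`parallel_lines_drift`), so the in-ball contribution is `O(θ)·Σ_k Γ|γ_k|/(ρ²Γ)·C₀R/R`; the parts
outside the ball contribute `Γ|γ|·C₀·Σ_n (2ⁿR√Γ)/(2ⁿR√Γ)³ = O(1/R²)` by length-regularity and dyadic summation.
Why it might fail: only through a slip in the constants' dependence (the statement lets `C` depend on everything
fixed before `Γ`). [folklore] -/
theorem stub_nearVerticalSubcritical :
    ∀ (N : ℕ) (γ : Fin N → ℝ) (α ρ K C₀ : ℝ), 0 < ρ → 0 < C₀ → ∃ C : ℝ, 0 ≤ C ∧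
      ∀ (θ R Γ : ℝ), 0 < θ → θ ≤ 1 → 1 ≤ R → 1 ≤ Γ →
        ∀ (Ξ : Fin N → ℝ → EuclideanSpace ℝ (Fin 3)) (w : Fin N → ℝ → ℝ),
          (∀ j, ContDiff ℝ 2 (Ξ j) ∧ Function.Injective (Ξ j) ∧ Differentiable ℝ (w j) ∧
              (∀ τ, ‖deriv (Ξ j) τ‖ = 1) ∧ (∀ τ, ‖iteratedDeriv 2 (Ξ j) τ‖ * Real.sqrt Γ ≤ K) ∧
              Tendsto (fun τ => ‖Ξ j τ‖) atTop atTop ∧ Tendsto (fun τ => ‖Ξ j τ‖) atBot atTop) →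
          (∀ j k, j ≠ k → ∀ τ σ, ρ * Real.sqrt Γ ≤ ‖Ξ j τ - Ξ k σ‖) →
          (∀ j (x : EuclideanSpace ℝ (Fin 3)), Integrable (fun σ : ℝ =>
              ((‖x - Ξ j σ‖ ^ 2 + 1) ^ (3 / 2 : ℝ))⁻¹ • cross (deriv (Ξ j) σ) (x - Ξ j σ))) →
          (∀ j τ, (∑ k : Fin N, (Γ * γ k / (4 * Real.pi)) • ∫ σ : ℝ,
                ((‖Ξ j τ - Ξ k σ‖ ^ 2 + 1) ^ (3 / 2 : ℝ))⁻¹ • cross (deriv (Ξ k) σ) (Ξ j τ - Ξ k σ))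
              + (1 / 2 : ℝ) • Ξ j τ - α • cross (EuclideanSpace.single (2 : Fin 3) (1 : ℝ)) (Ξ j τ)
              = w j τ • deriv (Ξ j) τ) →
          (∀ (k : Fin N) (x : EuclideanSpace ℝ (Fin 3)) (D : ℝ), Real.sqrt Γ ≤ D →
              volume {τ : ℝ | ‖Ξ k τ - x‖ ≤ D} ≤ ENNReal.ofReal (C₀ * D)) →
          ∀ (j : Fin N) (τs : ℝ), w j τs = 0 →
            (∀ (k : Fin N) (τ : ℝ), ‖Ξ k τ - Ξ j τs‖ ≤ R * Real.sqrt Γ →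
                ‖cross (deriv (Ξ k) τ) (EuclideanSpace.single (2 : Fin 3) (1 : ℝ))‖ ≤ θ) →
            deriv (w j) τs ≤ 1 / 2 + C * (θ + 1 / R) := by
  sorry

/-! ## Composition -/

/-- **The negation skeleton theorem**: the three stubs compose to `¬ SkeletonEquilibrium` (sorry-free):
choose `θ = 1/(4(C+1))`, `R = 4(C+1)`, so that the subcriticality bound reads `w′(τ*) ≤ 1`, and evaluate the crux
at `Γ₀ = max Γ₁ 1`. -/
theorem not_SkeletonEquilibrium_of :
    ¬ Theses.FilamentSkeletonRss.SkeletonEquilibrium := by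
  intro h
  obtain ⟨N, γ, α, δ, ρ, K, hN, hα, hδ, hρ, hγ, hfam⟩ := h
  -- length-regularity constant of the data
  obtain ⟨C₀, hC₀, hreg⟩ := stub_lengthRegular N γ α ρ K hα hρ
  -- subcriticality constant
  obtain ⟨C, hC, hsub⟩ := stub_nearVerticalSubcritical N γ α ρ K C₀ hρ hC₀
  -- tolerances
  set θ : ℝ := 1 / (4 * (C + 1)) with hθ_def
  set R : ℝ := 4 * (C + 1) with hR_def
  have hC1 : 0 < C + 1 := by linarith
  have hθ : 0 < θ := by rw [hθ_def]; positivity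
  have hθ1 : θ ≤ 1 := by
    rw [hθ_def, div_le_one (by positivity)]; linarith
  have hR : 1 ≤ R := by rw [hR_def]; linarith
  -- verticality threshold
  obtain ⟨Γ₁, hvert⟩ := stub_kelvinSonicVerticality N γ α ρ K C₀ hα hρ hC₀ θ hθ R hR
  -- evaluate the crux at Γ₀ = max Γ₁ 1
  obtain ⟨Γ, hΓ₀, hΓpos, Ξ, w, h1, h2, h3, h4, h5⟩ := hfam (max Γ₁ 1)
  have hΓ₁ : Γ₁ ≤ Γ := le_trans (le_max_left _ _) hΓ₀
  have hΓ1 : 1 ≤ Γ := le_trans (le_max_right _ _) hΓ₀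
  -- a filament and its stagnation point
  set j : Fin N := ⟨0, hN⟩ with hj
  obtain ⟨τs, hz, huniq, hsc⟩ := h5 j
  -- length regularity at this Γ
  have hL := hreg Γ hΓ1 Ξ w h1 h2 h3 h4
  -- near-verticality around Ξ j τs
  have hv := hvert Γ hΓ₁ hΓ1 Ξ w h1 h2 h3 h4 hL j τs hz
  -- subcriticality
  have hw := hsub θ R Γ hθ hθ1 hR hΓ1 Ξ w h1 h2 h3 h4 hL j τs hz hv
  -- the chosen tolerances give C * (θ + 1/R) ≤ 1/2
  have hsum : θ + 1 / R = 1 / (2 * (C + 1)) := by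
    rw [hθ_def, hR_def]; field_simp; ring
  have hkey : C * (θ + 1 / R) ≤ 1 / 2 := by
    rw [hsum]
    rw [show C * (1 / (2 * (C + 1))) = C / (2 * (C + 1)) by ring]
    rw [div_le_iff₀ (by positivity)]
    linarith
  -- contradiction with (SC): 3/2 + δ ≤ w′(τ*) ≤ 1/2 + 1/2
  linarith

end Summit.NavierStokesRegularity.NavierStokesRegularity.Cruxes.SkeletonEquilibrium.KelvinSonicNegation
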